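import Summits.Ventures.PercRepro0.NewmanCluster

/-!
# R_MID-12 · NEWMAN TRANSFER — the partition, the counting bound and the box identity (seat p2, part 2/3)

Lean twin of proofs/D7TRANSFER-p2-v1.md §3–§4 (cell pub-perc-repro0; lead RULING H (11)), on the
definitions of `NewmanCluster.lean`:

* the PARTITION (Lemma 2 (a)): `∑_{F ∈ animals} w_F(p) = 1` (`sum_w_eq_one`) and its sub-family
  form `∑_{F ∈ animals, φ F} w_F(p) = P_p(φ (boxKF ω))` (`sum_w_filter_eq`);
* `E_p |C_L(0)| = χ^L_p` through the partition (`sum_card_vert_mul_w`), the counting bound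
  `|F| ≤ d · |vert F|` (`card_le_d_mul_card_vert`), hence `∑_F |F| w_F ≤ d · χ^L_p` (`sum_card_mul_w_le`);
* the BOX IDENTITY (Lemma 3): from two termwise derivatives of the finite sum `≡ 1` on `(0, 1)`,
  Hammond's (24) `∑_F D_F w_F = 0` (`sum_D_mul_w`), (25) (`sum_D_sq_mul_w_eq`), and
  `∑_F D_F(p)² w_F(p) = (∑_F |F| w_F(p)) / (p² (1 − p))` (`sum_D_sq_mul_w`), so that
  `Q_L(p) ≤ d · χ^L_p / (p² (1 − p))` (`sum_D_sq_mul_w_le`) for every `p ∈ (0, 1)`.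

Continued in `NewmanTransfer.lean`. Census evidence only (the D7 door's TRANSFER): nothing here bears
on the hypothesis `∫_0^{p_c} χ^{1/2} < ∞` for any `d`, nothing on `T(d)`, `3 ≤ d ≤ 10`.
-/

namespace Summit.Ventures.PercRepro0.Newman

open MeasureTheory ProbabilityTheory unitInterval Set Filter Topology
open Summit.Ventures.PercRepro0.Defs
open scoped ENNReal NNReal Classical

variable {d : ℕ}

/-! ### The partition -/

/-- The events `{boxKF = F}`, `F` an animal, are pairwise disjoint. -/
theorem pairwiseDisjoint_boxKF (L : ℕ) :
    (↑(animals d L) : Set (Finset (Sym2 (Vertex d)))).PairwiseDisjoint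
      (fun F => {ω : Config d | boxKF d L ω = F}) := by
  intro F _ G _ hFG
  refine Set.disjoint_left.2 fun ω hF hG => hFG ?_
  simp only [Set.mem_setOf_eq] at hF hG
  rw [← hF, ← hG]

/-- Measurability of `{boxKF = F}` for an animal `F`. -/
theorem measurableSet_boxKF_eq' {L : ℕ} {F : Finset (Sym2 (Vertex d))} (hF : F ∈ animals d L) :
    MeasurableSet {ω : Config d | boxKF d L ω = F} := by
  obtain ⟨η, rfl⟩ := exists_of_mem_animals hF
  exact measurableSet_boxKF_eq L η

/-- The weight of an animal is the probability of its event. -/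
theorem P_eq_w {L : ℕ} {F : Finset (Sym2 (Vertex d))} (hF : F ∈ animals d L) (p : I) :
    (P d p {ω : Config d | boxKF d L ω = F}).toReal = w d L F p := by
  obtain ⟨η, rfl⟩ := exists_of_mem_animals hF
  exact P_boxKF_eq L η p

/-- LEMMA 2 (a), sub-family form: `∑_{F ∈ animals, φ F} w_F(p) = P_p(φ (boxKF ω))`. -/
theorem sum_w_filter_eq (L : ℕ) (φ : Finset (Sym2 (Vertex d)) → Prop) [DecidablePred φ] (p : I) :
    ∑ F ∈ (animals d L).filter φ, w d L F p = (P d p {ω : Config d | φ (boxKF d L ω)}).toReal := by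
  have hunion : {ω : Config d | φ (boxKF d L ω)} =
      ⋃ F ∈ (animals d L).filter φ, {ω : Config d | boxKF d L ω = F} := by
    ext ω
    simp only [Set.mem_setOf_eq, Set.mem_iUnion, Finset.mem_filter, exists_prop]
    constructor
    · intro h
      exact ⟨boxKF d L ω, ⟨boxKF_mem_animals L ω, h⟩, rfl⟩
    · rintro ⟨F, ⟨_, hφ⟩, rfl⟩
      exact hφ
  rw [hunion, measure_biUnion_finset
    ((pairwiseDisjoint_boxKF L).subset (Finset.coe_subset.2 (Finset.filter_subset _ _)))
    (fun F hF => measurableSet_boxKF_eq' (Finset.mem_filter.1 hF).1)]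
  rw [ENNReal.toReal_sum (fun F _ => measure_ne_top _ _)]
  exact Finset.sum_congr rfl fun F hF => (P_eq_w (Finset.mem_filter.1 hF).1 p).symm

/-- LEMMA 2 (a): `∑_{F ∈ animals} w_F(p) = 1`. -/
theorem sum_w_eq_one (L : ℕ) (p : I) : ∑ F ∈ animals d L, w d L F p = 1 := by
  have := sum_w_filter_eq (d := d) L (fun _ => True) p
  rw [Finset.filter_true_of_mem (fun _ _ => trivial)] at this
  simpa only [Set.setOf_true, measure_univ, ENNReal.toReal_one] using this

/-! ### `E_p |C_L(0)| = χ^L_p` through the partition -/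

/-- The vertex set of `boxKF ω` is the box cluster, inside `Λ_L`. -/
theorem mem_vertF_boxKF {L : ℕ} {ω : Config d} {x : Vertex d} :
    x ∈ vertF d L (boxKF d L ω) ↔ x ∈ Sharp.boxF d L ∧ x ∈ boxCluster d L ω := by
  simp only [vertF, Finset.mem_filter, coe_boxKF, vert_boxK]

/-- `∑_F |vert F| w_F(p) = χ^L_p`. -/
theorem sum_card_vert_mul_w (L : ℕ) (p : I) :
    ∑ F ∈ animals d L, ((vertF d L F).card : ℝ) * w d L F p = (ChiLower.chiBoxE d L p).toReal := by
  have hcard : ∀ F : Finset (Sym2 (Vertex d)),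
      ((vertF d L F).card : ℝ) = ∑ x ∈ Sharp.boxF d L, if x ∈ vertF d L F then (1 : ℝ) else 0 := by
    intro F
    rw [Finset.sum_boole, Finset.filter_mem_eq_inter,
      Finset.inter_eq_right.2 (show vertF d L F ⊆ Sharp.boxF d L from Finset.filter_subset _ _)]
  have hswap : ∑ F ∈ animals d L, ((vertF d L F).card : ℝ) * w d L F p =
      ∑ x ∈ Sharp.boxF d L, ∑ F ∈ animals d L, if x ∈ vertF d L F then w d L F p else 0 := by
    rw [Finset.sum_comm]
    refine Finset.sum_congr rfl fun F _ => ?_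
    rw [hcard F, Finset.sum_mul]
    refine Finset.sum_congr rfl fun x _ => ?_
    split_ifs <;> simp
  rw [hswap]
  unfold ChiLower.chiBoxE
  rw [ENNReal.toReal_sum (fun _ _ => measure_ne_top _ _)]
  refine Finset.sum_congr rfl fun x hx => ?_
  have h := sum_w_filter_eq (d := d) L (fun F => x ∈ vertF d L F) p
  rw [Finset.sum_filter] at h
  refine h.trans ?_
  congr 2
  ext ω
  simp only [Set.mem_setOf_eq, mem_vertF_boxKF, mem_boxCluster_iff]
  exact ⟨fun h => h.2, fun h => ⟨hx, h⟩⟩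

/-! ### Counting: `|F| ≤ d · |vert F|` -/

/-- A unit step back and forth returns. -/
theorem step_step_false_true (x : Vertex d) (i : Fin d) :
    L2.step (L2.step x i false) i true = x := by
  simp [L2.step, Function.update_idem]

/-- Every lattice bond is `s(x, x + e_i)` for an endpoint `x` and a direction `i`. -/
theorem exists_step_true_of_mem_bonds {e : Sym2 (Vertex d)} (he : e ∈ bonds d) :
    ∃ x : Vertex d, ∃ i : Fin d, x ∈ e ∧ e = s(x, L2.step x i true) := by
  induction e using Sym2.ind with
  | _ a b =>
    have hadj : (lattice d).Adj a b := adj_of_mem_bonds he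
    obtain ⟨i, bb, hib⟩ := L2.exists_step_of_adj hadj
    cases bb with
    | true => exact ⟨a, i, Sym2.mem_mk_left a b, by rw [hib]⟩
    | false =>
      refine ⟨b, i, Sym2.mem_mk_right a b, ?_⟩
      rw [← hib, step_step_false_true, Sym2.eq_swap]

/-- Every bond of a finite bond set `F ⊆ bonds d` has its endpoints in `vertF F` (inside `Λ_L`). -/
theorem mem_vertF_of_mem {L : ℕ} {F : Finset (Sym2 (Vertex d))} (hF : ↑F ⊆ boxBonds d L)
    {e : Sym2 (Vertex d)} (he : e ∈ F) {x : Vertex d} (hx : x ∈ e) : x ∈ vertF d L F := by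
  refine Finset.mem_filter.2 ⟨Sharp.mem_boxF.2 (hF (Finset.mem_coe.2 he) x hx), Or.inr ⟨e, he, hx⟩⟩

/-- The counting bound `|F| ≤ d · |vert F|` for a bond set of the box. -/
theorem card_le_d_mul_card_vert {L : ℕ} {F : Finset (Sym2 (Vertex d))} (hb : ↑F ⊆ bonds d)
    (hF : ↑F ⊆ boxBonds d L) : F.card ≤ d * (vertF d L F).card := by
  have hsub : F ⊆ (vertF d L F ×ˢ (Finset.univ : Finset (Fin d))).image
      (fun xi : Vertex d × Fin d => s(xi.1, L2.step xi.1 xi.2 true)) := by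
    intro e he
    obtain ⟨x, i, hx, hxe⟩ := exists_step_true_of_mem_bonds (hb (Finset.mem_coe.2 he))
    refine Finset.mem_image.2 ⟨(x, i), Finset.mem_product.2 ⟨mem_vertF_of_mem hF he hx, Finset.mem_univ _⟩, ?_⟩
    exact hxe.symm
  calc F.card ≤ _ := Finset.card_le_card hsub
    _ ≤ (vertF d L F ×ˢ (Finset.univ : Finset (Fin d))).card := Finset.card_image_le
    _ = (vertF d L F).card * d := by rw [Finset.card_product, Finset.card_univ, Fintype.card_fin]
    _ = d * (vertF d L F).card := mul_comm _ _

/-- Animals are bond sets of the box. -/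
theorem subset_boxBonds_of_mem_animals {L : ℕ} {F : Finset (Sym2 (Vertex d))} (hF : F ∈ animals d L) :
    ↑F ⊆ boxBonds d L := by
  obtain ⟨η, rfl⟩ := exists_of_mem_animals hF
  rw [coe_boxKF]
  exact boxK_subset_boxBonds L η

/-- Animals are sets of genuine bonds. -/
theorem subset_bonds_of_mem_animals {L : ℕ} {F : Finset (Sym2 (Vertex d))} (hF : F ∈ animals d L) :
    ↑F ⊆ bonds d := by
  obtain ⟨η, rfl⟩ := exists_of_mem_animals hF
  rw [coe_boxKF]
  exact boxK_subset_bonds L η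

/-- `∑_F |F| w_F(p) ≤ d · χ^L_p`. -/
theorem sum_card_mul_w_le (L : ℕ) (p : I) :
    ∑ F ∈ animals d L, (F.card : ℝ) * w d L F p ≤ d * (ChiLower.chiBoxE d L p).toReal := by
  rw [← sum_card_vert_mul_w, Finset.mul_sum]
  refine Finset.sum_le_sum fun F hF => ?_
  rw [← mul_assoc]
  refine mul_le_mul_of_nonneg_right ?_ (w_nonneg L F p.2.1 p.2.2)
  exact_mod_cast card_le_d_mul_card_vert (subset_bonds_of_mem_animals hF) (subset_boxBonds_of_mem_animals hF)

/-! ### The box identity (Lemma 3): two termwise derivatives of the finite sum `≡ 1` -/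

/-- The score `D_F(p) = |F|/p − |∂F|/(1 − p)`. -/
noncomputable def D (d L : ℕ) (F : Finset (Sym2 (Vertex d))) (p : ℝ) : ℝ :=
  (F.card : ℝ) / p - ((boxExitF d L F).card : ℝ) / (1 - p)

/-- `n · q^{n−1} = (n/q) · q^n` for `q ≠ 0` (natural subtraction handled). -/
theorem cast_mul_pow_sub_one (n : ℕ) {q : ℝ} (hq : q ≠ 0) :
    (n : ℝ) * q ^ (n - 1) = (n : ℝ) / q * q ^ n := by
  cases n with
  | zero => simp
  | succ k =>
    rw [Nat.succ_sub_one, pow_succ]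
    field_simp

/-- `w_F′ = D_F · w_F` on `(0, 1)`. -/
theorem hasDerivAt_w (L : ℕ) (F : Finset (Sym2 (Vertex d))) {p : ℝ} (h0 : 0 < p) (h1 : p < 1) :
    HasDerivAt (w d L F) (D d L F p * w d L F p) p := by
  have h1' : (1 : ℝ) - p ≠ 0 := by linarith
  have hp : p ≠ 0 := h0.ne'
  have ha := (hasDerivAt_pow F.card p)
  have hb : HasDerivAt (fun q : ℝ => (1 - q) ^ (boxExitF d L F).card)
      (((boxExitF d L F).card : ℝ) * (1 - p) ^ ((boxExitF d L F).card - 1) * (-1)) p :=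
    (hasDerivAt_pow _ (1 - p)).comp p ((hasDerivAt_id p).const_sub 1)
  have hprod := ha.mul hb
  have hfun : w d L F = fun q => q ^ F.card * (1 - q) ^ (boxExitF d L F).card := rfl
  rw [hfun]
  refine hprod.congr_deriv ?_
  rw [cast_mul_pow_sub_one F.card hp, cast_mul_pow_sub_one (boxExitF d L F).card h1']
  unfold D
  beta_reduce
  ring

/-- `D_F′(p) = −|F|/p² − |∂F|/(1 − p)²` on `(0, 1)`. -/
theorem hasDerivAt_D (L : ℕ) (F : Finset (Sym2 (Vertex d))) {p : ℝ} (h0 : 0 < p) (h1 : p < 1) :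
    HasDerivAt (D d L F)
      (-((F.card : ℝ) / p ^ 2) - ((boxExitF d L F).card : ℝ) / (1 - p) ^ 2) p := by
  have h1' : (1 : ℝ) - p ≠ 0 := by linarith
  have hp : p ≠ 0 := h0.ne'
  have ha : HasDerivAt (fun q : ℝ => (F.card : ℝ) / q) (-((F.card : ℝ) / p ^ 2)) p := by
    have := (hasDerivAt_inv hp).const_mul (F.card : ℝ)
    refine this.congr_deriv ?_ |>.congr_of_eventuallyEq ?_
    · field_simp
    · exact Filter.Eventually.of_forall fun q => by simp [div_eq_mul_inv]
  have hb : HasDerivAt (fun q : ℝ => ((boxExitF d L F).card : ℝ) / (1 - q))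
      (((boxExitF d L F).card : ℝ) / (1 - p) ^ 2) p := by
    have h := ((hasDerivAt_id p).const_sub 1).inv h1'
    have := h.const_mul ((boxExitF d L F).card : ℝ)
    refine this.congr_deriv ?_ |>.congr_of_eventuallyEq ?_
    · simp only [id]
      field_simp
    · exact Filter.Eventually.of_forall fun q => by simp [div_eq_mul_inv]
  exact ha.sub hb

/-- The finite sum of weights is identically `1` on `[0, 1]` (Lemma 2 (a) in real form). -/
theorem sum_w_eq_one_real (L : ℕ) {p : ℝ} (h0 : 0 ≤ p) (h1 : p ≤ 1) :
    ∑ F ∈ animals d L, w d L F p = 1 := by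
  have := sum_w_eq_one (d := d) L (clamp p)
  rwa [PcChi.coe_clamp_of_mem ⟨h0, h1⟩] at this

/-- Hammond's (24): `∑_F D_F w_F = 0` on `(0, 1)`. -/
theorem sum_D_mul_w (L : ℕ) {p : ℝ} (h0 : 0 < p) (h1 : p < 1) :
    ∑ F ∈ animals d L, D d L F p * w d L F p = 0 := by
  have hder : HasDerivAt (fun q => ∑ F ∈ animals d L, w d L F q)
      (∑ F ∈ animals d L, D d L F p * w d L F p) p := by
    have h := HasDerivAt.sum (u := animals d L) fun F _ => hasDerivAt_w L F h0 h1
    refine h.congr_of_eventuallyEq (Filter.Eventually.of_forall fun q => ?_)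
    exact (Finset.sum_apply q _ _).symm
  have hconst : HasDerivAt (fun q => ∑ F ∈ animals d L, w d L F q) 0 p := by
    refine (hasDerivAt_const p (1 : ℝ)).congr_of_eventuallyEq ?_
    filter_upwards [Ioo_mem_nhds h0 h1] with q hq
    exact sum_w_eq_one_real L hq.1.le hq.2.le
  exact hder.unique hconst

/-- Hammond's (25): `∑_F D_F² w_F = ∑_F (|F|/p² + |∂F|/(1 − p)²) w_F` on `(0, 1)`. -/
theorem sum_D_sq_mul_w_eq (L : ℕ) {p : ℝ} (h0 : 0 < p) (h1 : p < 1) :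
    ∑ F ∈ animals d L, D d L F p ^ 2 * w d L F p =
      ∑ F ∈ animals d L, ((F.card : ℝ) / p ^ 2 + ((boxExitF d L F).card : ℝ) / (1 - p) ^ 2) * w d L F p := by
  have hder : HasDerivAt (fun q => ∑ F ∈ animals d L, D d L F q * w d L F q)
      (∑ F ∈ animals d L,
        ((-((F.card : ℝ) / p ^ 2) - ((boxExitF d L F).card : ℝ) / (1 - p) ^ 2) * w d L F p +
          D d L F p * (D d L F p * w d L F p))) p := by
    have h := HasDerivAt.sum (u := animals d L) fun F _ =>
      (hasDerivAt_D L F h0 h1).mul (hasDerivAt_w L F h0 h1)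
    refine h.congr_of_eventuallyEq (Filter.Eventually.of_forall fun q => ?_)
    exact (Finset.sum_apply q (animals d L) (fun F q => D d L F q * w d L F q)).symm
  have hzero : HasDerivAt (fun q => ∑ F ∈ animals d L, D d L F q * w d L F q) 0 p := by
    refine (hasDerivAt_const p (0 : ℝ)).congr_of_eventuallyEq ?_
    filter_upwards [Ioo_mem_nhds h0 h1] with q hq
    exact sum_D_mul_w (d := d) L hq.1 hq.2
  have h := hder.unique hzero
  have h' : ∑ F ∈ animals d L, D d L F p ^ 2 * w d L F p -
      ∑ F ∈ animals d L, ((F.card : ℝ) / p ^ 2 + ((boxExitF d L F).card : ℝ) / (1 - p) ^ 2) * w d L F p = 0 := by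
    rw [← Finset.sum_sub_distrib, ← h]
    refine Finset.sum_congr rfl fun F _ => ?_
    ring
  linarith

/-- The exit-count identity from (24): `∑_F |∂F| w_F = ((1 − p)/p) ∑_F |F| w_F`. -/
theorem sum_exit_mul_w (L : ℕ) {p : ℝ} (h0 : 0 < p) (h1 : p < 1) :
    ∑ F ∈ animals d L, ((boxExitF d L F).card : ℝ) * w d L F p =
      (1 - p) / p * ∑ F ∈ animals d L, (F.card : ℝ) * w d L F p := by
  have h := sum_D_mul_w (d := d) L h0 h1
  have hp : p ≠ 0 := h0.ne'
  have h1' : (1 : ℝ) - p ≠ 0 := by linarith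
  unfold D at h
  have h2 : ∑ F ∈ animals d L, (F.card : ℝ) * w d L F p / p -
      ∑ F ∈ animals d L, ((boxExitF d L F).card : ℝ) * w d L F p / (1 - p) = 0 := by
    rw [← Finset.sum_sub_distrib, ← h]
    refine Finset.sum_congr rfl fun F _ => ?_
    ring
  rw [← Finset.sum_div, ← Finset.sum_div] at h2
  field_simp at h2 ⊢
  linarith

/-- LEMMA 3 (the box identity): `∑_F D_F(p)² w_F(p) = (∑_F |F| w_F(p)) / (p² (1 − p))` on `(0, 1)`. -/
theorem sum_D_sq_mul_w (L : ℕ) {p : ℝ} (h0 : 0 < p) (h1 : p < 1) :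
    ∑ F ∈ animals d L, D d L F p ^ 2 * w d L F p =
      (∑ F ∈ animals d L, (F.card : ℝ) * w d L F p) / (p ^ 2 * (1 - p)) := by
  rw [sum_D_sq_mul_w_eq L h0 h1]
  have hp : p ≠ 0 := h0.ne'
  have h1' : (1 : ℝ) - p ≠ 0 := by linarith
  have hsplit : ∑ F ∈ animals d L,
      ((F.card : ℝ) / p ^ 2 + ((boxExitF d L F).card : ℝ) / (1 - p) ^ 2) * w d L F p =
      (∑ F ∈ animals d L, (F.card : ℝ) * w d L F p) / p ^ 2 +
        (∑ F ∈ animals d L, ((boxExitF d L F).card : ℝ) * w d L F p) / (1 - p) ^ 2 := by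
    rw [Finset.sum_div, Finset.sum_div, ← Finset.sum_add_distrib]
    refine Finset.sum_congr rfl fun F _ => ?_
    ring
  rw [hsplit, sum_exit_mul_w L h0 h1]
  field_simp
  ring

/-- LEMMA 3 + counting: `Q_L(p) ≤ d · χ^L_p / (p² (1 − p))` for every `p ∈ (0, 1)`. -/
theorem sum_D_sq_mul_w_le (L : ℕ) {p : ℝ} (h0 : 0 < p) (h1 : p < 1) :
    ∑ F ∈ animals d L, D d L F p ^ 2 * w d L F p ≤
      d * (ChiLower.chiBoxE d L (clamp p)).toReal / (p ^ 2 * (1 - p)) := by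
  rw [sum_D_sq_mul_w L h0 h1]
  have hpos : 0 < p ^ 2 * (1 - p) := by
    have : (0 : ℝ) < 1 - p := by linarith
    positivity
  refine div_le_div_of_nonneg_right ?_ hpos.le
  have := sum_card_mul_w_le (d := d) L (clamp p)
  rwa [PcChi.coe_clamp_of_mem ⟨h0.le, h1.le⟩] at this

end Summit.Ventures.PercRepro0.Newman
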